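import Literature.Geometry.Lorentzian.KerrDeSitterHiddenSymmetryEnergy
import Literature.Geometry.Lorentzian.KerrDeSitterRealFrequencyModes
import Literature.Geometry.Lorentzian.KerrDeSitterSuperradiantThresholds
import HarnessLib

/-!
# Casals–Teixeira da Costa, proof of Theorem 3.10, Step 2 at a REAL frequency: the Wronskian
# identity for the `m₂ ↔ m₃`-transformed radial equation on subextremal Kerr–de Sitter and the
# unique continuation it appeals to

Theorems and definitions only (NO named facts). Companion of
`KerrDeSitterHiddenSymmetryEnergy.lean` (Step 2 for `Im ω > 0`) and of
`KerrDeSitterRealFrequencyModes.lean` (Step 1 for `Im ω = 0`, `s = 0`). Source: M. Casals,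
R. Teixeira da Costa, *Hidden spectral symmetries and mode stability of subextremal Kerr(-de Sitter)
black holes*, Commun. Math. Phys. 394 (2022) 797–832, arXiv:2105.13329 [CasalsTeixeiradacosta2022];
held arXiv text = v1 (Theorem 3.11 / Corollary 3.10, eqs. (3.25)–(3.27), pp. 17–18; = v3 Theorem 3.10
/ Corollary 3.9). The printed paragraph (v1 p. 18, end of Step 2):

> "Now consider `Im ω = 0`. The potential (3.27) is real and so, from (3.29) and the boundary
> conditions on `ũ`, we obtain
> `ω[(ω−mϖ₁) − (ω−mϖ₀)κ₁/κ₀]|ũ(−∞)|² + ω[(ω−mϖ₂) + (ω−mϖ₀)κ₂/κ₀]|ũ(+∞)|² = 0`.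
> (Note that the factors of `ω` outside the square brackets can be replaced by any linear combination
> of `ω` and `m`, and so we need not impose `ω ≠ 0` in what follows.) Thus, unless we have `m ≠ 0`,
> `(ϖ₁/κ₁−ϖ₀/κ₀)/(1/κ₁−1/κ₀) < ω/m < (ϖ₂/κ₂+ϖ₀/κ₀)/(1/κ₂+1/κ₀)`, we may infer, as before, by a
> unique continuation argument, that `ũ ≡ 0`."

What this file PROVES, in the boundary-flux (Wronskian) form used throughout this directory (no `z*`
variable, no square roots; `R̃` the solution of the normal form (3.25)
`z(z−1)(z−z₂)R̃″ + C̃(z)R̃ = 0`, `C̃ = ctdcTildeCoeff` of `KerrDeSitterHiddenSymmetryKernel.lean`, with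
the (3.26) branches `R̃ = (z−1)^{½+η₀+η₁}·h` near `1⁺`, `R̃ = (z₂−z)^{½−η₀−η₂}·g` near `z₂⁻`):

* `tendsto_flux_of_cpowBranch_re_eq_half` — endpoint value of the Wronskian density `S′·S̄` of a
  branch `S = u^q g` with `Re q = ½` EXACTLY (the real-frequency case of (3.26): `Re η_j = 0`):
  `S′S̄ → q·c·|g(x₀)|²` (`c = u′`). The twin of `tendsto_flux_of_cpowBranch_half` (`Re q > ½`,
  limit `0`) and of `tendsto_boundaryFlux_of_cpowBranch_of_re_eq_zero` (`Re z = 0`).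
* `hasDerivAt_wronskianFlux_of_im_eq_zero`, `boundaryIdentity_of_im_eq_zero` — for a REAL
  coefficient ("the potential (3.27) is real") the flux `J = Im(R̃′·conj R̃)` is conserved on `(a,b)`,
  and comparing its two endpoint values gives `Im q₁·|h(a)|² + Im q₂·|g(b)|² = 0` — the printed
  display, with `|h(1)|², |g(z₂)|²` the squared horizon amplitudes (`= |ũ(∓∞)|²` up to the positive
  weights `z₂ − 1`, `z₂(z₂−1)`).
* `ctdcTildeCoeff_ofReal_of_I_mul` — `C̃(z)` is real for real `z` when `η_j = i·e_j` (`e_j ∈ ℝ`, i.e.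
  `ω ∈ ℝ`) and the `λ̄`-block is real.
* `ctdcTildeQ₁`, `ctdcTildeQ₂`, `ctdcTildeCoeff_indicial_one`, `ctdcTildeCoeff_indicial_z₂` — the
  INDICIAL identities of (3.25) at `z = 1` (exponent `½ + η₀ + η₁`) and `z = z₂`
  (exponent `½ − η₀ − η₂`): after peeling off the (3.26) branch, the zeroth-order coefficient of the
  equation for the amplitude extends continuously across the horizon (exact algebra, for all complex
  parameters) — the input of the tree's unique-continuation lemma
  `eq_zero_near_of_cpowBranch_zero[_left]` (`KerrDeSitterRealFrequencyModes.lean`, reduced there to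
  `Kerr.Costa2019.eq_zero_of_regularSingular`).
* `ctdcTilde_eq_zero_of_eventAmplitude_eq_zero`, `ctdcTilde_eq_zero_of_cosmoAmplitude_eq_zero` —
  "by a unique continuation argument": a solution of (3.25)–(3.26) (ANY complex `ω`, `λ̄`) whose
  smooth horizon amplitude vanishes at `z = 1` (resp. `z = z₂`) is identically zero on `(1, z₂)`.
* `im_exponent_one_eq`, `im_exponent_z₂_eq` — on subextremal Kerr–de Sitter with `a ≠ 0` and real
  `ω`: `Im(½+η₀+η₁) = −(w₁−w₀)(ω − mΩ_low)`, `Im(½−η₀−η₂) = −(w₀+w₂)(ω − mΩ_SR)`, `w_j = 1/(2κ_j)`,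
  `w₁ > w₀` (`κ₁ < κ₀`, `surfaceGravity_rPlus_lt_rMinus`), `Ω_low, Ω_SR` the printed thresholds in
  closed form (`superradiantLower/Upper_eq_weighted`) — i.e. the two square brackets of the display.
* `ctdcStep2Real_of_normalFormModeData` — ★ THE THEOREM, in the shape consumed by the pub-kds kernel
  (`RouteW`, twin of `ctdcStep2_of_normalFormModeData`): on subextremal Kerr–de Sitter with
  `0 ≤ a`, for `Im ω = 0`, `ω ≠ 0`, `Im λ̄ = 0` and `m = 0 ∨ ω/m ∉ (Ω_low, Ω_SR)`, every normal-form
  mode datum of (3.25)–(3.26) vanishes identically on `(1, z₂)`.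

What is NOT here: the transformation producing `R̃` from a Teukolsky mode (route W's `Transfer`,
`EulerRL`, `GaugeGlue`, in `Summits/Ventures/KdS/` and `Literature/Analysis/ODE/HeunEuler*.lean`),
hence nothing about the radial Teukolsky equation itself; the half-integer clause `|s| ∈ {½, 3/2}`
of Theorem 3.10's second bullet (printed via Step 1 and the Teukolsky–Starobinsky identities, not via
Step 2); `ω = 0`.

## References
* [CasalsTeixeiradacosta2022] arXiv:2105.13329 v1: Cor. 3.10 (3.25)–(3.26) p. 16; Thm 3.11 proof,
  Step 2, the paragraph "Now consider `Im ω = 0`" and the closing identities, p. 18 (= v3 Cor. 3.9 /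
  Thm 3.10).
* R. Teixeira da Costa, Commun. Math. Phys. 378 (2020) 705–781, Prop. 3.8 (4), Lemma 3.14 (the
  regular-singular uniqueness step, `RegularSingularVanishing.lean`). [Costa2019]
-/

noncomputable section

open Complex Set Filter Topology

open scoped ComplexConjugate

namespace Literature.Geometry.Lorentzian.KerrDeSitter

/-! ### Boundary flux of a branch with exponent of real part exactly `½` -/

/-- **Endpoint value of the Wronskian density for a branch `S = u^q g` with `Re q = ½`** (`u` affine,
`u(x₀) = 0`, `u′ = c`, `u > 0` on the side `J`, `g` smooth near `x₀`): `S′·S̄ → q·c·|g(x₀)|²` as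
`x → x₀` within `J` (`S′S̄ = u^{2Re q − 1}(qc|g|² + u g′ḡ)` and `u^{2Re q−1} = 1`). The real-frequency
(`Re η_j = 0`) boundary values in Step 2 of the printed proof: the (3.26) exponents `½ + η₀ + η₁`,
`½ − η₀ − η₂` then have real part exactly `½`. [cite: CasalsTeixeiradacosta2022, Theorem 3.10 (proof, Step 2)] -/
theorem tendsto_flux_of_cpowBranch_re_eq_half
    {U J : Set ℝ} {x₀ : ℝ} (hU : IsOpen U) (hx₀ : x₀ ∈ U) (hJ : IsOpen J) (hJU : J ⊆ U)
    {g : ℝ → ℂ} (hg : ContDiffOn ℝ ((⊤ : ℕ∞) : WithTop ℕ∞) g U)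
    {u : ℝ → ℝ} {c : ℝ} (hu : ∀ x, HasDerivAt u c x) (hu0 : u x₀ = 0) (hupos : ∀ x ∈ J, 0 < u x)
    {q : ℂ} (hq : q.re = 1 / 2) {S S' : ℝ → ℂ} (hS : ∀ x ∈ J, HasDerivAt S (S' x) x)
    (hSg : ∀ x ∈ J, S x = ((u x : ℝ) : ℂ) ^ q * g x) :
    Tendsto (fun x => S' x * conj (S x)) (𝓝[J] x₀) (𝓝 (q * (c : ℂ) * (g x₀ * conj (g x₀)))) := by
  have h1 : (1 : WithTop ℕ∞) ≤ ((⊤ : ℕ∞) : WithTop ℕ∞) := by exact_mod_cast le_top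
  have h0 : ((⊤ : ℕ∞) : WithTop ℕ∞) ≠ 0 := by simp
  have hgd : DifferentiableOn ℝ g U := hg.differentiableOn h0
  have hgc : ContinuousAt g x₀ :=
    (hgd.continuousOn.continuousWithinAt hx₀).continuousAt (hU.mem_nhds hx₀)
  have hg'c : ContinuousAt (deriv g) x₀ :=
    ((hg.continuousOn_deriv_of_isOpen hU h1).continuousWithinAt hx₀).continuousAt (hU.mem_nhds hx₀)
  -- the derivative of `S` on `J`, from the branch representation
  have hS' : ∀ x ∈ J, S' x = q * ((u x : ℝ) : ℂ) ^ (q - 1) * (c : ℂ) * g x +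
      ((u x : ℝ) : ℂ) ^ q * deriv g x := by
    intro x hx
    have hgx : HasDerivAt g (deriv g x) x :=
      ((hgd x (hJU hx)).differentiableAt (hU.mem_nhds (hJU hx))).hasDerivAt
    have hux : HasDerivAt (fun y => ((u y : ℝ) : ℂ)) (c : ℂ) x := (hu x).ofReal_comp
    have hslit : ((u x : ℝ) : ℂ) ∈ slitPlane := Complex.ofReal_mem_slitPlane.2 (hupos x hx)
    have hpow' : HasDerivAt ((fun w : ℂ => w ^ q) ∘ fun y => ((u y : ℝ) : ℂ))
        (q * ((u x : ℝ) : ℂ) ^ (q - 1) * (c : ℂ)) x :=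
      (Complex.hasStrictDerivAt_cpow_const (c := q) hslit).hasDerivAt.comp x hux
    have hpow : HasDerivAt (fun y => ((u y : ℝ) : ℂ) ^ q)
        (q * ((u x : ℝ) : ℂ) ^ (q - 1) * (c : ℂ)) x := by
      simpa only [Function.comp_def] using hpow'
    have hprod := hpow.mul hgx
    have heq : S =ᶠ[𝓝 x] fun y => ((u y : ℝ) : ℂ) ^ q * g y :=
      Filter.eventually_of_mem (hJ.mem_nhds hx) fun y hy => hSg y hy
    exact (hS x hx).unique (hprod.congr_of_eventuallyEq heq)
  -- the Wronskian density on `J`: `S'·conj S = q c |g|² + u g' ḡ` (uses `u^q · conj(u^q) = u`)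
  have hflux : ∀ x ∈ J, S' x * conj (S x) =
      q * (c : ℂ) * (g x * conj (g x)) + ((u x : ℝ) : ℂ) * (deriv g x * conj (g x)) := by
    intro x hx
    have hU0 : 0 < u x := hupos x hx
    have hne : ((u x : ℝ) : ℂ) ≠ 0 := by exact_mod_cast hU0.ne'
    set P : ℂ := ((u x : ℝ) : ℂ) ^ q with hP
    have e1 : ((u x : ℝ) : ℂ) * ((u x : ℝ) : ℂ) ^ (q - 1) = P := by
      rw [hP, cpow_sub _ _ hne, cpow_one]
      field_simp
    have e2 : P * conj P = ((u x : ℝ) : ℂ) := by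
      rw [hP, Complex.mul_conj, Complex.normSq_eq_norm_sq, Complex.norm_cpow_eq_rpow_re_of_pos hU0,
        hq, ← Real.rpow_natCast, ← Real.rpow_mul hU0.le]
      norm_num
    have hmain : ((u x : ℝ) : ℂ) * (S' x * conj (S x)) =
        ((u x : ℝ) : ℂ) * (q * (c : ℂ) * (g x * conj (g x)) +
          ((u x : ℝ) : ℂ) * (deriv g x * conj (g x))) := by
      rw [hS' x hx, hSg x hx, map_mul, ← hP]
      linear_combination (q * (c : ℂ) * g x * conj (g x) * conj P) * e1 +
        (q * (c : ℂ) * (g x * conj (g x)) + ((u x : ℝ) : ℂ) * (deriv g x * conj (g x))) * e2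
    exact mul_left_cancel₀ hne hmain
  -- the model expression tends to `q c |g(x₀)|²`
  have hu_t : Tendsto u (𝓝 x₀) (𝓝 0) := by
    simpa [hu0] using (hu x₀).continuousAt.tendsto
  have t3 : Tendsto g (𝓝 x₀) (𝓝 (g x₀)) := hgc.tendsto
  have t3c : Tendsto (fun x => conj (g x)) (𝓝 x₀) (𝓝 (conj (g x₀))) :=
    (Complex.continuous_conj.tendsto _).comp t3
  have t4 : Tendsto (deriv g) (𝓝 x₀) (𝓝 (deriv g x₀)) := hg'c.tendsto
  have hb : Tendsto (fun x => q * (c : ℂ) * (g x * conj (g x)) +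
      ((u x : ℝ) : ℂ) * (deriv g x * conj (g x))) (𝓝 x₀)
      (𝓝 (q * (c : ℂ) * (g x₀ * conj (g x₀)) + ((0 : ℝ) : ℂ) * (deriv g x₀ * conj (g x₀)))) :=
    ((t3.mul t3c).const_mul _).add (hu_t.ofReal.mul (t4.mul t3c))
  simp only [Complex.ofReal_zero, zero_mul, add_zero] at hb
  refine (hb.mono_left nhdsWithin_le_nhds).congr' ?_
  filter_upwards [self_mem_nhdsWithin] with x hx
  exact (hflux x hx).symm

/-! ### A real coefficient: the Wronskian flux `Im(R′·conj R)` is conserved -/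

/-- Pure algebra: `Im(−C|R|²/L + |R₁|²) = 0` for real `L` and `Im C = 0`.
[cite: CasalsTeixeiradacosta2022, Theorem 3.10 (proof, Step 2)] -/
theorem im_wronskianFluxDeriv_eq_zero (C R R₁ : ℂ) (L : ℝ) (hC : C.im = 0) :
    (-(C * R) / (L : ℂ) * conj R + R₁ * conj R₁).im = 0 := by
  have e : -(C * R) / (L : ℂ) * conj R + R₁ * conj R₁ =
      -(C * (R * conj R)) / (L : ℂ) + R₁ * conj R₁ := by ring
  rw [e, Complex.mul_conj, Complex.mul_conj]
  simp [Complex.div_ofReal_im, hC]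

/-- **"The potential is real": conservation of the Wronskian flux.** If `R` solves
`L(z)·R″ + C(z)·R = 0` on `(a, b)` with `L` real, nowhere zero, and `Im C = 0` there, then
`J = Im(R′·conj R)` has derivative `0` on `(a, b)` (`J′ = Im(R″R̄ + |R′|²) = −Im C·|R|²/L = 0`). For the
normal form (3.25) at a real frequency this is the constancy of `Q^T[ũ]` in (3.29) (`Im ω = 0`,
`Im Ṽ = 0`). [cite: CasalsTeixeiradacosta2022, Theorem 3.10 (proof, Step 2), (3.29)] -/
theorem hasDerivAt_wronskianFlux_of_im_eq_zero {a b : ℝ} {L : ℝ → ℝ} {C : ℝ → ℂ}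
    (hL : ∀ z ∈ Ioo a b, L z ≠ 0) (hC : ∀ z ∈ Ioo a b, (C z).im = 0) {R R₁ R₂ : ℝ → ℂ}
    (hode : ∀ z ∈ Ioo a b, HasDerivAt R (R₁ z) z ∧ HasDerivAt R₁ (R₂ z) z ∧
      (L z : ℂ) * R₂ z + C z * R z = 0) :
    ∀ z ∈ Ioo a b, HasDerivAt (fun x => (R₁ x * conj (R x)).im) 0 z := by
  intro z hz
  obtain ⟨h1, h2, heq⟩ := hode z hz
  have hLz : (L z : ℂ) ≠ 0 := by exact_mod_cast hL z hz
  have hRbar : HasDerivAt (fun y => conj (R y)) (conj (R₁ z)) z := by simpa using h1.star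
  have hprod := h2.mul hRbar
  have hR₂ : R₂ z = -(C z * R z) / (L z : ℂ) := by
    rw [eq_div_iff hLz]
    linear_combination heq
  have hF : HasDerivAt (fun y => R₁ y * conj (R y))
      (-(C z * R z) / (L z : ℂ) * conj (R z) + R₁ z * conj (R₁ z)) z := by
    refine hprod.congr_deriv ?_
    rw [hR₂]
  have hG := Complex.imCLM.hasFDerivAt.comp_hasDerivAt z hF
  simp only [Function.comp_def, Complex.imCLM_apply] at hG
  rw [im_wronskianFluxDeriv_eq_zero _ _ _ _ (hC z hz)] at hG
  exact hG

/-- **The real-frequency boundary identity** (the printed display, Wronskian form). Let `R` solve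
`L·R″ + C·R = 0` on `(a, b)` with `L` real nowhere zero and `Im C = 0`, and let
`R = (z−a)^{q₁}·h` near `a⁺`, `R = (b−z)^{q₂}·g` near `b⁻` with `h, g` smooth across the endpoints
and `Re q₁ = Re q₂ = ½`. Then `Im q₁·|h(a)|² + Im q₂·|g(b)|² = 0`: the conserved flux
`J = Im(R′·conj R)` tends to `Im q₁·|h(a)|²` at `a⁺` and to `−Im q₂·|g(b)|²` at `b⁻`
(Cauchy mean value theorem with endpoint limits). [cite: CasalsTeixeiradacosta2022, Theorem 3.10 (proof, Step 2)] -/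
theorem boundaryIdentity_of_im_eq_zero {a b : ℝ} (hab : a < b) {L : ℝ → ℝ} {C : ℝ → ℂ}
    (hL : ∀ z ∈ Ioo a b, L z ≠ 0) (hC : ∀ z ∈ Ioo a b, (C z).im = 0) {R R₁ R₂ : ℝ → ℂ}
    (hode : ∀ z ∈ Ioo a b, HasDerivAt R (R₁ z) z ∧ HasDerivAt R₁ (R₂ z) z ∧
      (L z : ℂ) * R₂ z + C z * R z = 0)
    {q₁ q₂ : ℂ} (hq₁ : q₁.re = 1 / 2) (hq₂ : q₂.re = 1 / 2)
    {e₁ : ℝ} (he₁ : 0 < e₁) {h : ℝ → ℂ}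
    (hh : ContDiffOn ℝ ((⊤ : ℕ∞) : WithTop ℕ∞) h (Ioo (a - e₁) (a + e₁)))
    (hRh : ∀ z ∈ Ioo a (a + e₁), R z = ((z - a : ℝ) : ℂ) ^ q₁ * h z)
    {e₂ : ℝ} (he₂ : 0 < e₂) {g : ℝ → ℂ}
    (hg : ContDiffOn ℝ ((⊤ : ℕ∞) : WithTop ℕ∞) g (Ioo (b - e₂) (b + e₂)))
    (hRg : ∀ z ∈ Ioo (b - e₂) b, R z = ((b - z : ℝ) : ℂ) ^ q₂ * g z) :
    q₁.im * normSq (h a) + q₂.im * normSq (g b) = 0 := by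
  set G : ℝ → ℝ := fun x => (R₁ x * conj (R x)).im with hGdef
  have hGd : ∀ z ∈ Ioo a b, HasDerivAt G 0 z := hasDerivAt_wronskianFlux_of_im_eq_zero hL hC hode
  -- the limit at `a⁺`
  have hb₁ : a < min (a + e₁) b := lt_min (by linarith) hab
  have hJ₁sub : Ioo a (min (a + e₁) b) ⊆ Ioo (a - e₁) (a + e₁) := fun x hx =>
    ⟨by linarith [hx.1], lt_of_lt_of_le hx.2 (min_le_left _ _)⟩
  have hflux₁ := tendsto_flux_of_cpowBranch_re_eq_half (x₀ := a) (U := Ioo (a - e₁) (a + e₁))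
    (J := Ioo a (min (a + e₁) b)) isOpen_Ioo ⟨by linarith, by linarith⟩ isOpen_Ioo hJ₁sub hh
    (u := fun x => x - a) (c := 1) (fun x => (hasDerivAt_id' x).sub_const _) (by simp)
    (fun x hx => by simp only [sub_pos]; exact hx.1) hq₁ (S := R) (S' := R₁)
    (fun x hx => (hode x ⟨hx.1, lt_of_lt_of_le hx.2 (min_le_right _ _)⟩).1)
    (fun x hx => hRh x ⟨hx.1, lt_of_lt_of_le hx.2 (min_le_left _ _)⟩)
  set L₁ : ℝ := (q₁ * ((1 : ℝ) : ℂ) * (h a * conj (h a))).im with hL₁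
  have hlim₁ : Tendsto G (𝓝[>] a) (𝓝 L₁) := by
    have t := (Complex.continuous_im.tendsto _).comp hflux₁
    rw [nhdsWithin_Ioo_eq_nhdsGT hb₁] at t
    exact t
  have hL₁val : L₁ = q₁.im * normSq (h a) := by
    rw [hL₁, Complex.mul_conj]
    simp
  -- the limit at `b⁻`
  have hb₂ : max (b - e₂) a < b := max_lt (by linarith) hab
  have hJ₂sub : Ioo (max (b - e₂) a) b ⊆ Ioo (b - e₂) (b + e₂) := fun x hx =>
    ⟨lt_of_le_of_lt (le_max_left _ _) hx.1, by linarith [hx.2]⟩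
  have hflux₂ := tendsto_flux_of_cpowBranch_re_eq_half (x₀ := b) (U := Ioo (b - e₂) (b + e₂))
    (J := Ioo (max (b - e₂) a) b) isOpen_Ioo ⟨by linarith, by linarith⟩ isOpen_Ioo hJ₂sub hg
    (u := fun x => b - x) (c := -1) (fun x => (hasDerivAt_id' x).const_sub _) (by simp)
    (fun x hx => by simp only [sub_pos]; exact hx.2) hq₂ (S := R) (S' := R₁)
    (fun x hx => (hode x ⟨lt_of_le_of_lt (le_max_right _ _) hx.1, hx.2⟩).1)
    (fun x hx => hRg x ⟨lt_of_le_of_lt (le_max_left _ _) hx.1, hx.2⟩)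
  set L₂ : ℝ := (q₂ * ((-1 : ℝ) : ℂ) * (g b * conj (g b))).im with hL₂
  have hlim₂ : Tendsto G (𝓝[<] b) (𝓝 L₂) := by
    have t := (Complex.continuous_im.tendsto _).comp hflux₂
    rw [nhdsWithin_Ioo_eq_nhdsLT hb₂] at t
    exact t
  have hL₂val : L₂ = -(q₂.im * normSq (g b)) := by
    rw [hL₂, Complex.mul_conj]
    simp
  -- conservation: `L₁ = L₂` (Cauchy mean value theorem with endpoint limits)
  have hLeq : L₁ = L₂ := by
    obtain ⟨c, -, hc⟩ := exists_ratio_hasDerivAt_eq_ratio_slope' (f := G)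
      (f' := fun _ => (0 : ℝ)) hab (g := id) (g' := fun _ => (1 : ℝ))
      (lfa := L₁) (lga := a) (lfb := L₂) (lgb := b)
      (fun x hx => hGd x hx) (fun x _ => hasDerivAt_id x) hlim₁
      ((continuous_id.tendsto _).mono_left nhdsWithin_le_nhds) hlim₂
      ((continuous_id.tendsto _).mono_left nhdsWithin_le_nhds)
    simp only [mul_zero, mul_one] at hc
    linarith
  rw [hL₁val, hL₂val] at hLeq
  linarith

/-! ### Global uniqueness along `(a, b)` for the normal form `L·R″ + C·R = 0` -/

/-- **Grönwall uniqueness along the interval.** A classical solution of `L(z)R″ + C(z)R = 0` on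
`(a, b)` (`L` real, continuous, nowhere zero; `C` continuous) that vanishes on a neighbourhood of one
point vanishes identically (`Literature.Analysis.ODE.eqOn_of_solution_Ioo`).
[cite: CasalsTeixeiradacosta2022, Theorem 3.10 (proof, Step 2)] -/
theorem normalForm_eq_zero_of_eventuallyEq_zero {a b : ℝ} {L : ℝ → ℝ} {C : ℝ → ℂ}
    (hLc : ContinuousOn L (Ioo a b)) (hL : ∀ z ∈ Ioo a b, L z ≠ 0)
    (hCc : ContinuousOn C (Ioo a b)) {R R₁ R₂ : ℝ → ℂ}
    (hode : ∀ z ∈ Ioo a b, HasDerivAt R (R₁ z) z ∧ HasDerivAt R₁ (R₂ z) z ∧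
      (L z : ℂ) * R₂ z + C z * R z = 0)
    {z₁ : ℝ} (hz₁ : z₁ ∈ Ioo a b) (h0 : ∀ᶠ z in 𝓝 z₁, R z = 0) :
    ∀ z ∈ Ioo a b, R z = 0 := by
  set p : ℝ → ℂ := fun _ => 0 with hp
  set q : ℝ → ℂ := fun z => -C z / (L z : ℂ) with hq
  have hLc' : ContinuousOn (fun z => (L z : ℂ)) (Ioo a b) :=
    Complex.continuous_ofReal.comp_continuousOn hLc
  have hLne : ∀ z ∈ Ioo a b, (L z : ℂ) ≠ 0 := fun z hz => by exact_mod_cast hL z hz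
  have hpc : ContinuousOn p (Ioo a b) := continuousOn_const
  have hqc : ContinuousOn q (Ioo a b) := hCc.neg.div hLc' hLne
  have hu : ∀ t ∈ Ioo a b, HasDerivAt R (R₁ t) t ∧ HasDerivAt R₁ (p t * R₁ t + q t * R t) t := by
    intro t ht
    obtain ⟨h1, h2, heq⟩ := hode t ht
    refine ⟨h1, h2.congr_deriv ?_⟩
    have hne := hLne t ht
    rw [hp, hq]
    field_simp
    linear_combination heq
  have hv : ∀ t ∈ Ioo a b,
      HasDerivAt (fun _ : ℝ => (0 : ℂ)) ((fun _ : ℝ => (0 : ℂ)) t) t ∧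
        HasDerivAt (fun _ : ℝ => (0 : ℂ))
          (p t * (fun _ : ℝ => (0 : ℂ)) t + q t * (fun _ : ℝ => (0 : ℂ)) t) t := by
    intro t _
    refine ⟨hasDerivAt_const t 0, ?_⟩
    simpa using hasDerivAt_const t (0 : ℂ)
  have hR0 : R z₁ = 0 := h0.self_of_nhds
  have hR'0 : R₁ z₁ = 0 := by
    have h1 := (hode z₁ hz₁).1
    have h2 : HasDerivAt R 0 z₁ :=
      (hasDerivAt_const z₁ (0 : ℂ)).congr_of_eventuallyEq (h0.mono fun r hr => hr)
    exact h1.unique h2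
  have key := _root_.Literature.Analysis.ODE.eqOn_of_solution_Ioo (𝕜 := ℂ) hpc hqc hz₁
    (u := R) (u' := R₁) (v := fun _ => (0 : ℂ)) (v' := fun _ => (0 : ℂ)) hu hv hR0 hR'0
  exact fun r hr => key.1 hr


/-! ### The (3.25) coefficient `C̃` is real at a real frequency -/

/-- **"The potential (3.27) is real"** for the normal-form coefficient `C̃` of (3.25): with
`η_j = i·e_j`, `e_j ∈ ℝ` (real `ω`: `η_j = (−1)^j i(ω−mϖ_j)/(2κ_j)`) and a real `λ̄`-block `LT`,
`C̃(z) ∈ ℝ` for real `z` (only `η_j²` and `η_iη_j` occur). [cite: CasalsTeixeiradacosta2022, (3.25) and Theorem 3.10 (proof, Step 2)] -/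
theorem ctdcTildeCoeff_ofReal_of_I_mul (s e₀ e₁ e₂ l z₂ r₀ r₁ r₂ z : ℝ) :
    ctdcTildeCoeff (s : ℂ) (I * e₀) (I * e₁) (I * e₂) (l : ℂ) (z₂ : ℂ) r₀ r₁ r₂ z =
      ((l + (s ^ 2 * (r₁ + r₂) ^ 2 * (z - (r₂ - r₀) * (r₁ + (r₀ + r₁ + r₂)) / (r₁ + r₂) ^ 2)
              + (1 / 2 : ℝ) * z * (r₀ + r₁) ^ 2) / ((r₁ - r₀) * (r₂ + (r₀ + r₁ + r₂)) * z)
          + z / (z₂ - z) * (-((z - 1) * e₂ ^ 2) - 2 * (z₂ - 1) * e₀ * e₂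
              - (z₂ - 1) ^ 2 / (z - 1) * e₀ ^ 2 - (1 / 4 : ℝ) * (z - 1))
          + z / (z - 1) * (-(2 * (z₂ - 1) * e₀ * e₁) - (z₂ - z) * e₁ ^ 2
              - (z₂ - z) / (4 * z ^ 2) + 2 * (z - 1) * e₁ * e₂) : ℝ) : ℂ) := by
  unfold ctdcTildeCoeff
  push_cast
  linear_combination ((z : ℂ) / ((z₂ : ℂ) - z) * (((z : ℂ) - 1) * (e₂ : ℂ) ^ 2
      + 2 * ((z₂ : ℂ) - 1) * e₀ * e₂ + ((z₂ : ℂ) - 1) ^ 2 / ((z : ℂ) - 1) * (e₀ : ℂ) ^ 2)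
    + (z : ℂ) / ((z : ℂ) - 1) * (2 * ((z₂ : ℂ) - 1) * e₀ * e₁ + ((z₂ : ℂ) - z) * (e₁ : ℂ) ^ 2
      - 2 * ((z : ℂ) - 1) * e₁ * e₂)) * Complex.I_sq

/-- Hence `Im C̃(z) = 0` for real `z` at a real frequency with real `λ̄`-block.
[cite: CasalsTeixeiradacosta2022, (3.25) and Theorem 3.10 (proof, Step 2)] -/
theorem im_ctdcTildeCoeff_of_I_mul (s e₀ e₁ e₂ l z₂ r₀ r₁ r₂ z : ℝ) :
    (ctdcTildeCoeff (s : ℂ) (I * e₀) (I * e₁) (I * e₂) (l : ℂ) (z₂ : ℂ) r₀ r₁ r₂ z).im = 0 := by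
  rw [ctdcTildeCoeff_ofReal_of_I_mul, ofReal_im]

/-! ### The indicial identities of (3.25) at `z = 1` and `z = z₂` (all complex parameters) -/

/-- The `s²`/`(r₀+r₁)²` term of `C̃` (regular at `z = 1` and `z = z₂`).
[cite: CasalsTeixeiradacosta2022, Corollary 3.10 (3.25)] -/
def ctdcTildeTs (s : ℂ) (r₀ r₁ r₂ : ℝ) (z : ℝ) : ℂ :=
  (s ^ 2 * ((r₁ : ℂ) + r₂) ^ 2 *
        ((z : ℂ) - ((r₂ : ℂ) - r₀) * ((r₁ : ℂ) + (r₀ + r₁ + r₂)) / ((r₁ : ℂ) + r₂) ^ 2)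
      + (1 / 2 : ℂ) * z * ((r₀ : ℂ) + r₁) ^ 2)
    / (((r₁ : ℂ) - r₀) * ((r₂ : ℂ) + (r₀ + r₁ + r₂)) * z)

/-- **The transformed zeroth-order coefficient at the event horizon `z = 1`.** Writing
`R̃ = (z−1)^{q₁} h` with `q₁ = ½ + η₀ + η₁` (3.26) in (3.25), `h` solves
`(z−1)h″ + 2q₁ h′ + Q₁ h = 0` with `z(z−z₂)(z−1)Q₁ = z(z−z₂)(q₁²−q₁) + C̃(z)(z−1)`; this `Q₁`, in
closed form, has NO pole at `z = 1` (the `1/(z−1)` parts cancel by the indicial equation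
`q₁(q₁−1) = (η₀+η₁)² − ¼`). [cite: CasalsTeixeiradacosta2022, Corollary 3.10 (3.25)–(3.26)] -/
def ctdcTildeQ₁ (s η₀ η₁ η₂ LT z₂ : ℂ) (r₀ r₁ r₂ : ℝ) (z : ℝ) : ℂ :=
  (LT + ctdcTildeTs s r₀ r₁ r₂ z
      + (z : ℂ) / (z₂ - z) *
          (((z : ℂ) - 1) * η₂ ^ 2 + 2 * (z₂ - 1) * η₀ * η₂ - (1 / 4 : ℂ) * ((z : ℂ) - 1))
      + (z : ℂ) * (2 * z₂ - 1 - z) * η₀ ^ 2 / (z₂ - z) + 2 * z * η₀ * η₁ - 2 * z * η₁ * η₂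
      + (z₂ - z) * ((z : ℂ) + 1) / (4 * z))
    / ((z : ℂ) * ((z : ℂ) - z₂))

/-- **The transformed zeroth-order coefficient at the cosmological horizon `z = z₂`.** Writing
`R̃ = (z₂−z)^{q₂} g` with `q₂ = ½ − η₀ − η₂` (3.26) in (3.25), `g` solves
`(z−z₂)g″ + 2q₂ g′ + Q₂ g = 0` with `z(z−1)(z−z₂)Q₂ = z(z−1)(q₂²−q₂) + C̃(z)(z−z₂)`; this `Q₂` has
NO pole at `z = z₂` (indicial equation `q₂(q₂−1) = (η₀+η₂)² − ¼`).
[cite: CasalsTeixeiradacosta2022, Corollary 3.10 (3.25)–(3.26)] -/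
def ctdcTildeQ₂ (s η₀ η₁ η₂ LT z₂ : ℂ) (r₀ r₁ r₂ : ℝ) (z : ℝ) : ℂ :=
  (LT + ctdcTildeTs s r₀ r₁ r₂ z + 2 * z * η₀ * η₂
      + (z : ℂ) * ((z : ℂ) + z₂ - 2) * η₀ ^ 2 / ((z : ℂ) - 1)
      + (z : ℂ) / ((z : ℂ) - 1) *
          (2 * (z₂ - 1) * η₀ * η₁ + (z₂ - z) * η₁ ^ 2 - (z₂ - z) / (4 * (z : ℂ) ^ 2)
            - 2 * ((z : ℂ) - 1) * η₁ * η₂))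
    / ((z : ℂ) * ((z : ℂ) - 1))

/-- **Indicial identity at `z = 1`**: `z(z−z₂)·(z−1)·Q₁(z) = z(z−z₂)(q₁² − q₁) + C̃(z)(z−1)`,
`q₁ = ½ + η₀ + η₁`, off the singular points (exact algebra).
[cite: CasalsTeixeiradacosta2022, Corollary 3.10 (3.25)–(3.26)] -/
theorem ctdcTildeCoeff_indicial_one (s η₀ η₁ η₂ LT z₂ : ℂ) {r₀ r₁ r₂ z : ℝ}
    (h10 : (r₁ : ℂ) - r₀ ≠ 0) (h23 : (r₂ : ℂ) + (r₀ + r₁ + r₂) ≠ 0) (h12 : (r₁ : ℂ) + r₂ ≠ 0)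
    (hz0 : (z : ℂ) ≠ 0) (hz1 : (z : ℂ) - 1 ≠ 0) (hz2 : z₂ - (z : ℂ) ≠ 0) :
    (z : ℂ) * ((z : ℂ) - z₂) * ((z : ℂ) - 1) * ctdcTildeQ₁ s η₀ η₁ η₂ LT z₂ r₀ r₁ r₂ z =
      (z : ℂ) * ((z : ℂ) - z₂) * ((1 / 2 + η₀ + η₁) ^ 2 - (1 / 2 + η₀ + η₁)) +
        ctdcTildeCoeff s η₀ η₁ η₂ LT z₂ r₀ r₁ r₂ z * ((z : ℂ) - 1) := by
  have hz2' : (z : ℂ) - z₂ ≠ 0 := fun h => hz2 (by linear_combination -h)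
  unfold ctdcTildeQ₁ ctdcTildeCoeff ctdcTildeTs
  field_simp
  ring

/-- **Indicial identity at `z = z₂`**: `z(z−1)·(z−z₂)·Q₂(z) = z(z−1)(q₂² − q₂) + C̃(z)(z−z₂)`,
`q₂ = ½ − η₀ − η₂`, off the singular points (exact algebra).
[cite: CasalsTeixeiradacosta2022, Corollary 3.10 (3.25)–(3.26)] -/
theorem ctdcTildeCoeff_indicial_z₂ (s η₀ η₁ η₂ LT z₂ : ℂ) {r₀ r₁ r₂ z : ℝ}
    (h10 : (r₁ : ℂ) - r₀ ≠ 0) (h23 : (r₂ : ℂ) + (r₀ + r₁ + r₂) ≠ 0) (h12 : (r₁ : ℂ) + r₂ ≠ 0)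
    (hz0 : (z : ℂ) ≠ 0) (hz1 : (z : ℂ) - 1 ≠ 0) (hz2 : z₂ - (z : ℂ) ≠ 0) :
    (z : ℂ) * ((z : ℂ) - 1) * ((z : ℂ) - z₂) * ctdcTildeQ₂ s η₀ η₁ η₂ LT z₂ r₀ r₁ r₂ z =
      (z : ℂ) * ((z : ℂ) - 1) * ((1 / 2 - η₀ - η₂) ^ 2 - (1 / 2 - η₀ - η₂)) +
        ctdcTildeCoeff s η₀ η₁ η₂ LT z₂ r₀ r₁ r₂ z * ((z : ℂ) - z₂) := by
  have hz2' : (z : ℂ) - z₂ ≠ 0 := fun h => hz2 (by linear_combination -h)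
  unfold ctdcTildeQ₂ ctdcTildeCoeff ctdcTildeTs
  field_simp
  ring

/-- `Q₁` is continuous at every real `z` with `z ≠ 0`, `z ≠ z₂` (in particular across `z = 1`).
[cite: CasalsTeixeiradacosta2022, Corollary 3.10 (3.25)–(3.26)] -/
theorem continuousAt_ctdcTildeQ₁ (s η₀ η₁ η₂ LT : ℂ) {z₂ r₀ r₁ r₂ : ℝ}
    (h10 : (r₁ : ℂ) - r₀ ≠ 0) (h23 : (r₂ : ℂ) + (r₀ + r₁ + r₂) ≠ 0) {x : ℝ}
    (hx0 : (x : ℂ) ≠ 0) (hx2 : (z₂ : ℂ) - (x : ℂ) ≠ 0) :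
    ContinuousAt (fun z => ctdcTildeQ₁ s η₀ η₁ η₂ LT (z₂ : ℂ) r₀ r₁ r₂ z) x := by
  have hx2' : (x : ℂ) - z₂ ≠ 0 := fun h => hx2 (by linear_combination -h)
  unfold ctdcTildeQ₁ ctdcTildeTs
  fun_prop (disch := simp [*])

/-- `Q₂` is continuous at every real `z` with `z ≠ 0`, `z ≠ 1` (in particular across `z = z₂`).
[cite: CasalsTeixeiradacosta2022, Corollary 3.10 (3.25)–(3.26)] -/
theorem continuousAt_ctdcTildeQ₂ (s η₀ η₁ η₂ LT : ℂ) {z₂ r₀ r₁ r₂ : ℝ}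
    (h10 : (r₁ : ℂ) - r₀ ≠ 0) (h23 : (r₂ : ℂ) + (r₀ + r₁ + r₂) ≠ 0) {x : ℝ}
    (hx0 : (x : ℂ) ≠ 0) (hx1 : (x : ℂ) - 1 ≠ 0) :
    ContinuousAt (fun z => ctdcTildeQ₂ s η₀ η₁ η₂ LT (z₂ : ℂ) r₀ r₁ r₂ z) x := by
  unfold ctdcTildeQ₂ ctdcTildeTs
  fun_prop (disch := simp [*])

/-- `C̃` is continuous at every real `z` off `{0, 1, z₂}`.
[cite: CasalsTeixeiradacosta2022, Corollary 3.10 (3.25)] -/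
theorem continuousAt_ctdcTildeCoeff (s η₀ η₁ η₂ LT : ℂ) {z₂ r₀ r₁ r₂ : ℝ}
    (h10 : (r₁ : ℂ) - r₀ ≠ 0) (h23 : (r₂ : ℂ) + (r₀ + r₁ + r₂) ≠ 0) {x : ℝ}
    (hx0 : (x : ℂ) ≠ 0) (hx1 : (x : ℂ) - 1 ≠ 0) (hx2 : (z₂ : ℂ) - (x : ℂ) ≠ 0) :
    ContinuousAt (fun z => ctdcTildeCoeff s η₀ η₁ η₂ LT (z₂ : ℂ) r₀ r₁ r₂ z) x := by
  unfold ctdcTildeCoeff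
  fun_prop (disch := simp [*])


/-! ### "By a unique continuation argument": a vanishing horizon amplitude forces `R̃ ≡ 0` -/

/-- `C̃` is continuous on `(1, z₂)`. [cite: CasalsTeixeiradacosta2022, Corollary 3.10 (3.25)] -/
theorem continuousOn_ctdcTildeCoeff_Ioo (s η₀ η₁ η₂ LT : ℂ) {z₂ r₀ r₁ r₂ : ℝ}
    (h10 : (r₁ : ℂ) - r₀ ≠ 0) (h23 : (r₂ : ℂ) + (r₀ + r₁ + r₂) ≠ 0) :
    ContinuousOn (fun z => ctdcTildeCoeff s η₀ η₁ η₂ LT (z₂ : ℂ) r₀ r₁ r₂ z) (Ioo 1 z₂) := by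
  intro x hx
  refine (continuousAt_ctdcTildeCoeff s η₀ η₁ η₂ LT h10 h23 ?_ ?_ ?_).continuousWithinAt
  · exact_mod_cast (show x ≠ 0 by linarith [hx.1])
  · exact_mod_cast (show x - 1 ≠ 0 by linarith [hx.1])
  · exact_mod_cast (show z₂ - x ≠ 0 by linarith [hx.2])

/-- **Unique continuation from the event horizon** (any complex `ω`, `λ̄`): let `R̃` solve (3.25)
`z(z−1)(z−z₂)R̃″ + C̃R̃ = 0` on `(1, z₂)` and have the (3.26) form `R̃ = (z−1)^{½+η₀+η₁}·h` near `1⁺`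
with `h` smooth across `z = 1` and `Re(1 + 2(η₀+η₁)) > 0` (true for `Im ω ≥ 0`). If the horizon
amplitude vanishes, `h(1) = 0`, then `R̃ ≡ 0` on `(1, z₂)` — the regular-singular uniqueness
`eq_zero_near_of_cpowBranch_zero` with the indicial identity `ctdcTildeCoeff_indicial_one`, then
Grönwall uniqueness along `(1, z₂)`. [cite: CasalsTeixeiradacosta2022, Theorem 3.10 (proof, Step 2)] -/
theorem ctdcTilde_eq_zero_of_eventAmplitude_eq_zero {s η₀ η₁ η₂ LT : ℂ} {z₂ r₀ r₁ r₂ : ℝ}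
    (hz₂ : 1 < z₂) (h10 : (r₁ : ℂ) - r₀ ≠ 0) (h23 : (r₂ : ℂ) + (r₀ + r₁ + r₂) ≠ 0)
    (h12 : (r₁ : ℂ) + r₂ ≠ 0) (hP0 : 0 < (2 * (1 / 2 + η₀ + η₁)).re)
    {R R₁ R₂ : ℝ → ℂ}
    (hode : ∀ z ∈ Ioo 1 z₂, HasDerivAt R (R₁ z) z ∧ HasDerivAt R₁ (R₂ z) z ∧
      ((z * (z - 1) * (z - z₂) : ℝ) : ℂ) * R₂ z +
        ctdcTildeCoeff s η₀ η₁ η₂ LT (z₂ : ℂ) r₀ r₁ r₂ z * R z = 0)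
    {e : ℝ} (he : 0 < e) {h : ℝ → ℂ}
    (hh : ContDiffOn ℝ ((⊤ : ℕ∞) : WithTop ℕ∞) h (Ioo (1 - e) (1 + e)))
    (hRh : ∀ z ∈ Ioo 1 (1 + e), R z = ((z - 1 : ℝ) : ℂ) ^ (1 / 2 + η₀ + η₁) * h z)
    (hh0 : h 1 = 0) :
    ∀ z ∈ Ioo 1 z₂, R z = 0 := by
  -- a common neighbourhood of `1` inside `(0, z₂)`
  set ε' : ℝ := min e (min 1 (z₂ - 1)) with hε'
  have hε'pos : 0 < ε' := lt_min he (lt_min one_pos (by linarith))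
  have hε'e : ε' ≤ e := min_le_left _ _
  have hε'1 : ε' ≤ 1 := (min_le_right _ _).trans (min_le_left _ _)
  have hε'2 : ε' ≤ z₂ - 1 := (min_le_right _ _).trans (min_le_right _ _)
  have hU : ∀ r ∈ Ioo (1 - ε') (1 + ε'), (r : ℂ) ≠ 0 ∧ (z₂ : ℂ) - (r : ℂ) ≠ 0 := fun r hr =>
    ⟨by exact_mod_cast (show r ≠ 0 by linarith [hr.1]),
      by exact_mod_cast (show z₂ - r ≠ 0 by linarith [hr.2])⟩
  have hJ : ∀ r ∈ Ioo 1 (1 + ε'), r ∈ Ioo 1 z₂ := fun r hr => ⟨hr.1, by linarith [hr.2]⟩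
  obtain ⟨T, hT, hzero⟩ := eq_zero_near_of_cpowBranch_zero (x₀ := 1) hε'pos
    (z := 1 / 2 + η₀ + η₁) (ℓ := fun r => r * (r - z₂)) (D := fun _ => 0)
    (V := fun r => ctdcTildeCoeff s η₀ η₁ η₂ LT (z₂ : ℂ) r₀ r₁ r₂ r) (f := h)
    (hh.mono fun r hr => ⟨by linarith [hr.1], by linarith [hr.2]⟩) hh0
    (R := R) (R' := R₁) (R'' := R₂)
    (fun r hr => by
      obtain ⟨h1, h2, heq⟩ := hode r (hJ r hr)
      refine ⟨h1, h2, ?_⟩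
      push_cast at heq ⊢
      linear_combination heq)
    (fun r hr => hRh r ⟨hr.1, lt_of_lt_of_le hr.2 (by linarith)⟩)
    (fun r hr => by
      have h1 : (0 : ℝ) < r := by linarith [hr.1]
      have h2 : r - z₂ < 0 := by linarith [hr.2]
      exact mul_ne_zero h1.ne' h2.ne)
    (P := fun _ => 2 * (1 / 2 + η₀ + η₁))
    (Q := fun r => ctdcTildeQ₁ s η₀ η₁ η₂ LT (z₂ : ℂ) r₀ r₁ r₂ r)
    continuousOn_const
    (fun r hr => (continuousAt_ctdcTildeQ₁ s η₀ η₁ η₂ LT h10 h23 (hU r hr).1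
      (hU r hr).2).continuousWithinAt)
    (by simpa using hP0)
    (fun r hr => by push_cast; ring)
    (fun r hr => by
      have hr0 : (r : ℂ) ≠ 0 := (hU r ⟨by linarith [hr.1], hr.2⟩).1
      have hr2 : (z₂ : ℂ) - (r : ℂ) ≠ 0 := (hU r ⟨by linarith [hr.1], hr.2⟩).2
      have hr1 : (r : ℂ) - 1 ≠ 0 := by exact_mod_cast (show r - 1 ≠ 0 by linarith [hr.1])
      have key := ctdcTildeCoeff_indicial_one s η₀ η₁ η₂ LT (z₂ : ℂ) h10 h23 h12 hr0 hr1 hr2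
      push_cast
      linear_combination key)
  -- a point of `(1, z₂)` with a neighbourhood where `R = 0`, then uniqueness along the interval
  set z₁ : ℝ := 1 + min T ε' / 2 with hz₁def
  have hmin : 0 < min T ε' := lt_min hT hε'pos
  have hz₁J : z₁ ∈ Ioo 1 (1 + min T ε') := ⟨by linarith, by linarith⟩
  have hz₁D : z₁ ∈ Ioo 1 z₂ :=
    hJ z₁ ⟨hz₁J.1, lt_of_lt_of_le hz₁J.2 (by linarith [min_le_right T ε'])⟩
  have hev : ∀ᶠ r in 𝓝 z₁, R r = 0 := by
    filter_upwards [isOpen_Ioo.mem_nhds hz₁J] with r hr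
    exact hzero r ⟨hr.1, lt_of_lt_of_le hr.2 (by linarith [min_le_left T ε'])⟩
  exact normalForm_eq_zero_of_eventuallyEq_zero (L := fun z => z * (z - 1) * (z - z₂))
    (by fun_prop) (fun z hz => mul_ne_zero (mul_ne_zero (by linarith [hz.1]) (by linarith [hz.1]))
      (by linarith [hz.2])) (continuousOn_ctdcTildeCoeff_Ioo s η₀ η₁ η₂ LT h10 h23) hode hz₁D hev

/-- **Unique continuation from the cosmological horizon** (any complex `ω`, `λ̄`): if `R̃` solves
(3.25) on `(1, z₂)`, has the (3.26) form `R̃ = (z₂−z)^{½−η₀−η₂}·g` near `z₂⁻` with `g` smooth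
across `z₂`, `Re(1 − 2(η₀+η₂)) > 0`, and `g(z₂) = 0`, then `R̃ ≡ 0` on `(1, z₂)`
(`eq_zero_near_of_cpowBranch_zero_left` with `ctdcTildeCoeff_indicial_z₂`).
[cite: CasalsTeixeiradacosta2022, Theorem 3.10 (proof, Step 2)] -/
theorem ctdcTilde_eq_zero_of_cosmoAmplitude_eq_zero {s η₀ η₁ η₂ LT : ℂ} {z₂ r₀ r₁ r₂ : ℝ}
    (hz₂ : 1 < z₂) (h10 : (r₁ : ℂ) - r₀ ≠ 0) (h23 : (r₂ : ℂ) + (r₀ + r₁ + r₂) ≠ 0)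
    (h12 : (r₁ : ℂ) + r₂ ≠ 0) (hP0 : 0 < (2 * (1 / 2 - η₀ - η₂)).re)
    {R R₁ R₂ : ℝ → ℂ}
    (hode : ∀ z ∈ Ioo 1 z₂, HasDerivAt R (R₁ z) z ∧ HasDerivAt R₁ (R₂ z) z ∧
      ((z * (z - 1) * (z - z₂) : ℝ) : ℂ) * R₂ z +
        ctdcTildeCoeff s η₀ η₁ η₂ LT (z₂ : ℂ) r₀ r₁ r₂ z * R z = 0)
    {e : ℝ} (he : 0 < e) {g : ℝ → ℂ}
    (hg : ContDiffOn ℝ ((⊤ : ℕ∞) : WithTop ℕ∞) g (Ioo (z₂ - e) (z₂ + e)))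
    (hRg : ∀ z ∈ Ioo (z₂ - e) z₂, R z = ((z₂ - z : ℝ) : ℂ) ^ (1 / 2 - η₀ - η₂) * g z)
    (hg0 : g z₂ = 0) :
    ∀ z ∈ Ioo 1 z₂, R z = 0 := by
  set ε' : ℝ := min e (z₂ - 1) with hε'
  have hε'pos : 0 < ε' := lt_min he (by linarith)
  have hε'e : ε' ≤ e := min_le_left _ _
  have hε'2 : ε' ≤ z₂ - 1 := min_le_right _ _
  have hU : ∀ r ∈ Ioo (z₂ - ε') (z₂ + ε'), (r : ℂ) ≠ 0 ∧ (r : ℂ) - 1 ≠ 0 := fun r hr =>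
    ⟨by exact_mod_cast (show r ≠ 0 by linarith [hr.1]),
      by exact_mod_cast (show r - 1 ≠ 0 by linarith [hr.1])⟩
  have hJ : ∀ r ∈ Ioo (z₂ - ε') z₂, r ∈ Ioo 1 z₂ := fun r hr => ⟨by linarith [hr.1], hr.2⟩
  obtain ⟨T, hT, hzero⟩ := eq_zero_near_of_cpowBranch_zero_left (x₀ := z₂) hε'pos
    (z := 1 / 2 - η₀ - η₂) (ℓ := fun r => r * (r - 1)) (D := fun _ => 0)
    (V := fun r => ctdcTildeCoeff s η₀ η₁ η₂ LT (z₂ : ℂ) r₀ r₁ r₂ r) (f := g)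
    (hg.mono fun r hr => ⟨by linarith [hr.1], by linarith [hr.2]⟩) hg0
    (R := R) (R' := R₁) (R'' := R₂)
    (fun r hr => by
      obtain ⟨h1, h2, heq⟩ := hode r (hJ r hr)
      refine ⟨h1, h2, ?_⟩
      push_cast at heq ⊢
      linear_combination heq)
    (fun r hr => hRg r ⟨lt_of_le_of_lt (by linarith) hr.1, hr.2⟩)
    (fun r hr => by
      have h1 : (0 : ℝ) < r := by linarith [hr.1]
      have h2 : 0 < r - 1 := by linarith [hr.1]
      exact mul_ne_zero h1.ne' h2.ne')
    (P := fun _ => 2 * (1 / 2 - η₀ - η₂))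
    (Q := fun r => ctdcTildeQ₂ s η₀ η₁ η₂ LT (z₂ : ℂ) r₀ r₁ r₂ r)
    continuousOn_const
    (fun r hr => (continuousAt_ctdcTildeQ₂ s η₀ η₁ η₂ LT h10 h23 (hU r hr).1
      (hU r hr).2).continuousWithinAt)
    (by simpa using hP0)
    (fun r hr => by push_cast; ring)
    (fun r hr => by
      have hr0 : (r : ℂ) ≠ 0 := (hU r ⟨hr.1, by linarith [hr.2]⟩).1
      have hr1 : (r : ℂ) - 1 ≠ 0 := (hU r ⟨hr.1, by linarith [hr.2]⟩).2
      have hr2 : (z₂ : ℂ) - (r : ℂ) ≠ 0 := by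
        exact_mod_cast (show z₂ - r ≠ 0 by linarith [hr.2])
      have key := ctdcTildeCoeff_indicial_z₂ s η₀ η₁ η₂ LT (z₂ : ℂ) h10 h23 h12 hr0 hr1 hr2
      push_cast
      linear_combination key)
  set z₁ : ℝ := z₂ - min T ε' / 2 with hz₁def
  have hmin : 0 < min T ε' := lt_min hT hε'pos
  have hz₁J : z₁ ∈ Ioo (z₂ - min T ε') z₂ := ⟨by linarith, by linarith⟩
  have hz₁D : z₁ ∈ Ioo 1 z₂ :=
    hJ z₁ ⟨lt_of_le_of_lt (by linarith [min_le_right T ε']) hz₁J.1, hz₁J.2⟩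
  have hev : ∀ᶠ r in 𝓝 z₁, R r = 0 := by
    filter_upwards [isOpen_Ioo.mem_nhds hz₁J] with r hr
    exact hzero r ⟨lt_of_le_of_lt (by linarith [min_le_left T ε']) hr.1, hr.2⟩
  exact normalForm_eq_zero_of_eventuallyEq_zero (L := fun z => z * (z - 1) * (z - z₂))
    (by fun_prop) (fun z hz => mul_ne_zero (mul_ne_zero (by linarith [hz.1]) (by linarith [hz.1]))
      (by linarith [hz.2])) (continuousOn_ctdcTildeCoeff_Ioo s η₀ η₁ η₂ LT h10 h23) hode hz₁D hev


/-! ### The two square brackets of the printed identity on subextremal Kerr–de Sitter -/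

section KdS

variable {M a Λ : ℝ}

/-- **First bracket.** For real `ω` and `a ≠ 0`:
`Im(½ + η₀ + η₁) = (ω−mϖ₀)/(2κ₀) − (ω−mϖ₁)/(2κ₁) = −½(1/κ₁ − 1/κ₀)(ω − m·Ω_low)`,
`Ω_low = (ϖ₁/κ₁ − ϖ₀/κ₀)/(1/κ₁ − 1/κ₀)` (`superradiantLower`, printed closed form
`2a/(L²Ξ − (r₀+r₁)²)`) — i.e. `−[(ω−mϖ₁) − (ω−mϖ₀)κ₁/κ₀]/(2κ₁)`.
[cite: CasalsTeixeiradacosta2022, Theorem 3.10 (proof, Step 2 and closing identities)] -/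
theorem im_exponent_one_eq (hsub : IsSubextremal M a Λ) (ha : a ≠ 0) (ωr m : ℝ) :
    (1 / 2 + etaCauchy M a Λ (ωr : ℂ) m + etaEvent M a Λ (ωr : ℂ) m).im =
      -((1 / surfaceGravity M a Λ (rPlus M a Λ) - 1 / surfaceGravity M a Λ (rMinus M a Λ)) / 2) *
        (ωr - m * superradiantLower M a Λ) := by
  have hκ0 := surfaceGravity_rMinus_pos hsub ha
  have hκ1 := surfaceGravity_rPlus_pos hsub
  have hlt := surfaceGravity_rPlus_lt_rMinus hsub ha
  have hA : 1 / surfaceGravity M a Λ (rPlus M a Λ) - 1 / surfaceGravity M a Λ (rMinus M a Λ) ≠ 0 := by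
    have : 1 / surfaceGravity M a Λ (rMinus M a Λ) < 1 / surfaceGravity M a Λ (rPlus M a Λ) :=
      one_div_lt_one_div_of_lt hκ1 hlt
    linarith
  have e := superradiantLower_eq_weighted hsub ha
  rw [div_eq_iff hA] at e
  have hre : ((1 : ℂ) / 2).im = 0 := by norm_num
  simp only [add_im, hre, etaCauchy_im, etaEvent_im, ofReal_re]
  linear_combination (m / 2) * e

/-- **Second bracket.** For real `ω` and `a ≠ 0`:
`Im(½ − η₀ − η₂) = −(ω−mϖ₀)/(2κ₀) − (ω−mϖ₂)/(2κ₂) = −½(1/κ₂ + 1/κ₀)(ω − m·Ω_SR)`,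
`Ω_SR = (ϖ₂/κ₂ + ϖ₀/κ₀)/(1/κ₂ + 1/κ₀)` (`superradiantUpper`, printed closed form `2a/(L²Ξ − (r₀+r₂)²)`)
— i.e. `−[(ω−mϖ₂) + (ω−mϖ₀)κ₂/κ₀]/(2κ₂)`.
[cite: CasalsTeixeiradacosta2022, Theorem 3.10 (proof, Step 2 and closing identities)] -/
theorem im_exponent_z₂_eq (hsub : IsSubextremal M a Λ) (ha : a ≠ 0) (ωr m : ℝ) :
    (1 / 2 - etaCauchy M a Λ (ωr : ℂ) m - etaCosmo M a Λ (ωr : ℂ) m).im =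
      -((1 / surfaceGravity M a Λ (rCosmo M a Λ) + 1 / surfaceGravity M a Λ (rMinus M a Λ)) / 2) *
        (ωr - m * superradiantUpper M a Λ) := by
  have hκ0 := surfaceGravity_rMinus_pos hsub ha
  have hκ2 := surfaceGravity_rCosmo_pos hsub
  have hB : 1 / surfaceGravity M a Λ (rCosmo M a Λ) + 1 / surfaceGravity M a Λ (rMinus M a Λ) ≠ 0 := by
    have : 0 < 1 / surfaceGravity M a Λ (rCosmo M a Λ) + 1 / surfaceGravity M a Λ (rMinus M a Λ) := by
      positivity
    exact this.ne'
  have e := superradiantUpper_eq_weighted hsub ha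
  rw [div_eq_iff hB] at e
  have hre : ((1 : ℂ) / 2).im = 0 := by norm_num
  simp only [sub_im, hre, etaCauchy_im, etaCosmo_im, ofReal_re]
  linear_combination (m / 2) * e

/-- **The sign analysis of the printed identity** ("Thus, unless we have `m ≠ 0`,
`Ω_low < ω/m < Ω_SR`, …"): on subextremal Kerr–de Sitter with `0 ≤ a`, for real `ω ≠ 0` with
`m = 0` or `ω/m ∉ (Ω_low, Ω_SR)`, the two coefficients `X₁ = Im(½+η₀+η₁)`, `X₂ = Im(½−η₀−η₂)` of
the boundary identity `X₁|h(1)|² + X₂|g(z₂)|² = 0` satisfy `X₁X₂ ≥ 0` and are not both zero (for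
`a = 0`: `ϖ_j = 0`, `η₀ = 0`, `X₁ = −ω/(2κ₁)`, `X₂ = −ω/(2κ₂)`).
[cite: CasalsTeixeiradacosta2022, Theorem 3.10 (proof, Step 2)] -/
theorem realAxis_exponent_signs (hsub : IsSubextremal M a Λ) (ha : 0 ≤ a) {ωr m : ℝ}
    (hω0 : ωr ≠ 0)
    (hthird : m = 0 ∨ ¬(superradiantLower M a Λ < ωr / m ∧ ωr / m < superradiantUpper M a Λ)) :
    0 ≤ (1 / 2 + etaCauchy M a Λ (ωr : ℂ) m + etaEvent M a Λ (ωr : ℂ) m).im *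
        (1 / 2 - etaCauchy M a Λ (ωr : ℂ) m - etaCosmo M a Λ (ωr : ℂ) m).im ∧
      ¬((1 / 2 + etaCauchy M a Λ (ωr : ℂ) m + etaEvent M a Λ (ωr : ℂ) m).im = 0 ∧
        (1 / 2 - etaCauchy M a Λ (ωr : ℂ) m - etaCosmo M a Λ (ωr : ℂ) m).im = 0) := by
  have hκ1 := surfaceGravity_rPlus_pos hsub
  have hκ2 := surfaceGravity_rCosmo_pos hsub
  rcases ha.eq_or_lt with h0 | hpos
  · -- `a = 0`: `η₀ = 0`, `ϖ_j = 0`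
    subst h0
    have hre : ((1 : ℂ) / 2).im = 0 := by norm_num
    have hϖ : ∀ r : ℝ, horizonAngVel 0 r = 0 := fun r => by simp [horizonAngVel]
    have hX₁ : (1 / 2 + etaCauchy M 0 Λ (ωr : ℂ) m + etaEvent M 0 Λ (ωr : ℂ) m).im =
        -(ωr / (2 * surfaceGravity M 0 Λ (rPlus M 0 Λ))) := by
      simp only [add_im, hre, etaCauchy_zero_a hsub, zero_im, etaEvent_im, ofReal_re, hϖ]
      ring
    have hX₂ : (1 / 2 - etaCauchy M 0 Λ (ωr : ℂ) m - etaCosmo M 0 Λ (ωr : ℂ) m).im =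
        -(ωr / (2 * surfaceGravity M 0 Λ (rCosmo M 0 Λ))) := by
      simp only [sub_im, hre, etaCauchy_zero_a hsub, zero_im, etaCosmo_im, ofReal_re, hϖ]
      ring
    rw [hX₁, hX₂]
    refine ⟨?_, ?_⟩
    · have : 0 ≤ ωr / (2 * surfaceGravity M 0 Λ (rPlus M 0 Λ)) *
          (ωr / (2 * surfaceGravity M 0 Λ (rCosmo M 0 Λ))) := by
        rw [div_mul_div_comm]
        exact div_nonneg (mul_self_nonneg ωr) (by positivity)
      linarith
    · rintro ⟨h1, -⟩
      have : ωr / (2 * surfaceGravity M 0 Λ (rPlus M 0 Λ)) = 0 := by linarith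
      rcases div_eq_zero_iff.1 this with h | h
      · exact hω0 h
      · exact (mul_pos two_pos hκ1).ne' h
  · -- `a > 0`
    have ha' : a ≠ 0 := hpos.ne'
    have hκ0 := surfaceGravity_rMinus_pos hsub ha'
    have hlt := surfaceGravity_rPlus_lt_rMinus hsub ha'
    obtain ⟨-, -, hΩ, -⟩ := superradiant_chain hsub hpos
    set A : ℝ := 1 / surfaceGravity M a Λ (rPlus M a Λ) - 1 / surfaceGravity M a Λ (rMinus M a Λ)
      with hAdef
    set B : ℝ := 1 / surfaceGravity M a Λ (rCosmo M a Λ) + 1 / surfaceGravity M a Λ (rMinus M a Λ)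
      with hBdef
    have hA : 0 < A := by
      have : 1 / surfaceGravity M a Λ (rMinus M a Λ) < 1 / surfaceGravity M a Λ (rPlus M a Λ) :=
        one_div_lt_one_div_of_lt hκ1 hlt
      rw [hAdef]; linarith
    have hB : 0 < B := by rw [hBdef]; positivity
    set Y₁ : ℝ := ωr - m * superradiantLower M a Λ with hY₁
    set Y₂ : ℝ := ωr - m * superradiantUpper M a Λ with hY₂
    rw [im_exponent_one_eq hsub ha' ωr m, im_exponent_z₂_eq hsub ha' ωr m]
    -- the product `Y₁ Y₂ ≥ 0` off the window
    have hY : 0 ≤ Y₁ * Y₂ := by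
      rcases hthird with hm | hwin
      · have e : Y₁ * Y₂ = ωr ^ 2 := by rw [hY₁, hY₂, hm]; ring
        rw [e]; positivity
      · by_cases hm : m = 0
        · have e : Y₁ * Y₂ = ωr ^ 2 := by rw [hY₁, hY₂, hm]; ring
          rw [e]; positivity
        · set t : ℝ := ωr / m with ht
          have hωt : ωr = m * t := by rw [ht]; field_simp
          have e : Y₁ * Y₂ = m ^ 2 * ((t - superradiantLower M a Λ) * (t - superradiantUpper M a Λ)) := by
            rw [hY₁, hY₂, hωt]; ring
          rw [e]
          refine mul_nonneg (sq_nonneg m) ?_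
          rcases not_and_or.mp hwin with h1 | h2
          · have h1' : t ≤ superradiantLower M a Λ := not_lt.mp h1
            exact mul_nonneg_of_nonpos_of_nonpos (by linarith) (by linarith)
          · have h2' : superradiantUpper M a Λ ≤ t := not_lt.mp h2
            exact mul_nonneg (by linarith) (by linarith)
    refine ⟨?_, ?_⟩
    · have e : -(A / 2) * Y₁ * (-(B / 2) * Y₂) = (A * B / 4) * (Y₁ * Y₂) := by ring
      rw [e]
      exact mul_nonneg (by positivity) hY
    · rintro ⟨h1, h2⟩
      have hY₁0 : Y₁ = 0 := by
        rcases mul_eq_zero.1 h1 with h | h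
        · exfalso; have : A / 2 ≠ 0 := by positivity
          exact this (neg_eq_zero.mp h)
        · exact h
      have hY₂0 : Y₂ = 0 := by
        rcases mul_eq_zero.1 h2 with h | h
        · exfalso; have : B / 2 ≠ 0 := by positivity
          exact this (neg_eq_zero.mp h)
        · exact h
      have hm : m * (superradiantUpper M a Λ - superradiantLower M a Λ) = 0 := by
        rw [hY₁] at hY₁0; rw [hY₂] at hY₂0; linarith
      rcases mul_eq_zero.1 hm with hm0 | hd
      · apply hω0; rw [hY₁, hm0] at hY₁0; linarith
      · linarith

end KdS


/-! ## Assembly for the pub-kds kernel: Step 2 at a real frequency, in the shape of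
`RouteW.SwappedEnergyVanishing` with the real-axis hypotheses -/

section Assembly

open Literature.Analysis.ODE

variable {M a Λ : ℝ}

/-- The `λ̄`-block at a real frequency with real `λ̄` is real. [cite: CasalsTeixeiradacosta2022, (3.25)] -/
theorem ctdcLT_ofReal (M a Λ : ℝ) (ωr m lr : ℝ) :
    ctdcLT M a Λ (ωr : ℂ) m (lr : ℂ) =
      ((3 / Λ / ((rCosmo M a Λ + (rMinus M a Λ + rPlus M a Λ + rCosmo M a Λ)) *
            (rPlus M a Λ - rMinus M a Λ)) *
          (lr - 2 * xi a Λ ^ 2 * a * m * ωr + xi a Λ ^ 2 * a ^ 2 * ωr ^ 2) : ℝ) : ℂ) := by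
  unfold ctdcLT
  push_cast
  ring

/-- At a real frequency `η = i·e` with `e = σ(ω − mϖ)/(2κ) ∈ ℝ`. [cite: CasalsTeixeiradacosta2022, (3.10)] -/
theorem etaOf_ofReal (σ ϖ κ ωr m : ℝ) :
    etaOf σ ϖ κ (ωr : ℂ) m = I * (((σ * (1 / (2 * κ)) * (ωr - m * ϖ) : ℝ) : ℂ)) := by
  rw [etaOf_eq_I_mul]
  push_cast
  ring

/-- **Casals–Teixeira da Costa, Theorem 3.10, Step 2 at a REAL frequency — in the shape of the
pub-kds kernel `RouteW`** (twin of `ctdcStep2_of_normalFormModeData`). On subextremal Kerr–de Sitter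
with `0 ≤ a`: if `Im ω = 0`, `ω ≠ 0`, `Im λ̄ = 0` (`λ̄ = lambdaBar a Λ s ω m λ`; automatic for a
genuine mode at real `aω`, `angularEigenvalue_real`) and `m = 0 ∨ ω/m ∉ (Ω_low, Ω_SR)`
(`superradiantLower`, `superradiantUpper`), then every `R̃` with normal-form mode data — a classical
solution of (3.25) `z(z−1)(z−z₂)R̃″ + C̃(z)R̃ = 0` on `(1, z₂)` (`z₂ = ctdcZ₂ r₋ r₊ r_c`,
`C̃ = ctdcTildeCoeff` with the `λ̄`-block `(3/Λ)(λ̄ − 2Ξ²amω + a²Ξ²ω²)/((r_c−r_neg)(r₊−r₋))`), of the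
form `(z−1)^{½+η₀+η₁}·h` near `1⁺` and `(z₂−z)^{½−η₀−η₂}·g` near `z₂⁻` with `h, g` smooth across —
vanishes identically on `(1, z₂)`. Printed argument: `C̃` is real, the Wronskian flux is conserved,
its endpoint values give `X₁|h(1)|² + X₂|g(z₂)|² = 0` with `X₁X₂ ≥ 0`, not both zero, off the window;
so one horizon amplitude vanishes and unique continuation at that regular singular point finishes.
[cite: CasalsTeixeiradacosta2022, Corollary 3.10 (3.25)–(3.26) and Theorem 3.10 (proof, Step 2, the case Im ω = 0)] -/
theorem ctdcStep2Real_of_normalFormModeData (hsub : IsSubextremal M a Λ) (ha : 0 ≤ a) {s : ℝ}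
    {ω : ℂ} {m : ℝ} {lam : ℂ} {R : ℝ → ℂ} (hω : ω.im = 0) (hω0 : ω ≠ 0)
    (hlam : (lambdaBar a Λ s ω m lam).im = 0)
    (hthird : m = 0 ∨
      ¬(superradiantLower M a Λ < ω.re / m ∧ ω.re / m < superradiantUpper M a Λ))
    (hode : ∃ R₁ R₂ : ℝ → ℂ, ∀ z ∈ Ioo 1 (ctdcZ₂ (rMinus M a Λ) (rPlus M a Λ) (rCosmo M a Λ)),
      HasDerivAt R (R₁ z) z ∧ HasDerivAt R₁ (R₂ z) z ∧
        GeneralHeun.lead ((ctdcZ₂ (rMinus M a Λ) (rPlus M a Λ) (rCosmo M a Λ) : ℝ) : ℂ) z * R₂ z +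
          ctdcTildeCoeff (s : ℂ) (etaCauchy M a Λ ω m) (etaEvent M a Λ ω m) (etaCosmo M a Λ ω m)
            (((3 / Λ : ℝ) : ℂ) *
                (lambdaBar a Λ s ω m lam - 2 * (xi a Λ : ℂ) ^ 2 * (a : ℂ) * (m : ℂ) * ω +
                  (a : ℂ) ^ 2 * (xi a Λ : ℂ) ^ 2 * ω ^ 2) /
              ((((rCosmo M a Λ - rNeg M a Λ) * (rPlus M a Λ - rMinus M a Λ)) : ℝ) : ℂ))
            ((ctdcZ₂ (rMinus M a Λ) (rPlus M a Λ) (rCosmo M a Λ) : ℝ) : ℂ)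
            (rMinus M a Λ) (rPlus M a Λ) (rCosmo M a Λ) z * R z = 0)
    (h1 : ∃ e : ℝ, 0 < e ∧ ∃ h : ℝ → ℂ, ContDiffOn ℝ ((⊤ : ℕ∞) : WithTop ℕ∞) h (Ioo (1 - e) (1 + e)) ∧
      ∀ z ∈ Ioo 1 (1 + e),
        R z = ((z - 1 : ℝ) : ℂ) ^ (1 / 2 + etaCauchy M a Λ ω m + etaEvent M a Λ ω m) * h z)
    (h2 : ∃ e : ℝ, 0 < e ∧ ∃ g : ℝ → ℂ, ContDiffOn ℝ ((⊤ : ℕ∞) : WithTop ℕ∞) g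
        (Ioo (ctdcZ₂ (rMinus M a Λ) (rPlus M a Λ) (rCosmo M a Λ) - e)
          (ctdcZ₂ (rMinus M a Λ) (rPlus M a Λ) (rCosmo M a Λ) + e)) ∧
      ∀ z ∈ Ioo (ctdcZ₂ (rMinus M a Λ) (rPlus M a Λ) (rCosmo M a Λ) - e)
          (ctdcZ₂ (rMinus M a Λ) (rPlus M a Λ) (rCosmo M a Λ)),
        R z = ((ctdcZ₂ (rMinus M a Λ) (rPlus M a Λ) (rCosmo M a Λ) - z : ℝ) : ℂ) ^
          (1 / 2 - etaCauchy M a Λ ω m - etaCosmo M a Λ ω m) * g z) :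
    ∀ z ∈ Ioo 1 (ctdcZ₂ (rMinus M a Λ) (rPlus M a Λ) (rCosmo M a Λ)), R z = 0 := by
  -- real frequency `ω = ωr`, real `λ̄ = lr`
  obtain ⟨ωr, rfl⟩ : ∃ ωr : ℝ, ω = (ωr : ℂ) :=
    ⟨ω.re, Complex.ext (by simp) (by simp [hω])⟩
  have hωr0 : ωr ≠ 0 := fun h0 => hω0 (by rw [h0]; simp)
  simp only [ofReal_re] at hthird
  obtain ⟨lr, hlr⟩ : ∃ lr : ℝ, lambdaBar a Λ s (ωr : ℂ) m lam = (lr : ℂ) :=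
    ⟨(lambdaBar a Λ s (ωr : ℂ) m lam).re, Complex.ext (by simp) (by simp [hlam])⟩
  set z₂ := ctdcZ₂ (rMinus M a Λ) (rPlus M a Λ) (rCosmo M a Λ) with hz₂def
  have hz₂ : 1 < z₂ := one_lt_ctdcZ₂_kds hsub
  have hsub' := hsub
  obtain ⟨hM, hΛ, h01, h12, -⟩ := hsub'
  have hr₀ := rMinus_nonneg M a Λ
  have h10 : ((rPlus M a Λ : ℝ) : ℂ) - (rMinus M a Λ : ℝ) ≠ 0 := by
    exact_mod_cast (show rPlus M a Λ - rMinus M a Λ ≠ 0 by linarith)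
  have h23 : ((rCosmo M a Λ : ℝ) : ℂ) + ((rMinus M a Λ : ℝ) + (rPlus M a Λ : ℝ) + (rCosmo M a Λ : ℝ))
      ≠ 0 := by
    exact_mod_cast (show rCosmo M a Λ + (rMinus M a Λ + rPlus M a Λ + rCosmo M a Λ) ≠ 0 by linarith)
  have h12' : ((rPlus M a Λ : ℝ) : ℂ) + (rCosmo M a Λ : ℝ) ≠ 0 := by
    exact_mod_cast (show rPlus M a Λ + rCosmo M a Λ ≠ 0 by linarith)
  -- the normal form with `C̃` written through the `λ̄`-block `ctdcLT`, and the real-cast lead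
  obtain ⟨R₁, R₂, hode⟩ := hode
  rw [ltBlock_eq_ctdcLT] at hode
  have hode' : ∀ z ∈ Ioo 1 z₂, HasDerivAt R (R₁ z) z ∧ HasDerivAt R₁ (R₂ z) z ∧
      ((z * (z - 1) * (z - z₂) : ℝ) : ℂ) * R₂ z +
        ctdcTildeCoeff (s : ℂ) (etaCauchy M a Λ ωr m) (etaEvent M a Λ ωr m) (etaCosmo M a Λ ωr m)
          (ctdcLT M a Λ ωr m (lambdaBar a Λ s ωr m lam)) (z₂ : ℂ)
          (rMinus M a Λ) (rPlus M a Λ) (rCosmo M a Λ) z * R z = 0 := by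
    intro z hz
    obtain ⟨hd1, hd2, heq⟩ := hode z hz
    refine ⟨hd1, hd2, ?_⟩
    rw [← generalHeun_lead_ofReal]
    exact heq
  -- "the potential is real"
  have hLT : ctdcLT M a Λ (ωr : ℂ) m (lambdaBar a Λ s (ωr : ℂ) m lam) =
      ((3 / Λ / ((rCosmo M a Λ + (rMinus M a Λ + rPlus M a Λ + rCosmo M a Λ)) *
            (rPlus M a Λ - rMinus M a Λ)) *
          (lr - 2 * xi a Λ ^ 2 * a * m * ωr + xi a Λ ^ 2 * a ^ 2 * ωr ^ 2) : ℝ) : ℂ) := by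
    rw [hlr]; exact ctdcLT_ofReal M a Λ ωr m lr
  have hC : ∀ z : ℝ, (ctdcTildeCoeff (s : ℂ) (etaCauchy M a Λ ωr m) (etaEvent M a Λ ωr m)
      (etaCosmo M a Λ ωr m) (ctdcLT M a Λ ωr m (lambdaBar a Λ s ωr m lam)) (z₂ : ℂ)
      (rMinus M a Λ) (rPlus M a Λ) (rCosmo M a Λ) z).im = 0 := by
    intro z
    simp only [etaCauchy, etaEvent, etaCosmo]
    rw [etaOf_ofReal, etaOf_ofReal, etaOf_ofReal, hLT]
    exact im_ctdcTildeCoeff_of_I_mul _ _ _ _ _ _ _ _ _ _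
  have hLne : ∀ z ∈ Ioo 1 z₂, z * (z - 1) * (z - z₂) ≠ 0 := fun z hz =>
    mul_ne_zero (mul_ne_zero (by linarith [hz.1]) (by linarith [hz.1])) (by linarith [hz.2])
  -- the exponents have real part exactly `½`
  have hre : ((1 : ℂ) / 2).re = 1 / 2 := by norm_num
  have hq₁ : (1 / 2 + etaCauchy M a Λ (ωr : ℂ) m + etaEvent M a Λ (ωr : ℂ) m).re = 1 / 2 := by
    simp only [add_re, hre, etaCauchy_re, etaEvent_re, ofReal_im, zero_div, neg_zero, add_zero]
  have hq₂ : (1 / 2 - etaCauchy M a Λ (ωr : ℂ) m - etaCosmo M a Λ (ωr : ℂ) m).re = 1 / 2 := by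
    simp only [sub_re, hre, etaCauchy_re, etaCosmo_re, ofReal_im, zero_div, neg_zero, sub_zero]
  obtain ⟨e₁, he₁, h, hh, hRh⟩ := h1
  obtain ⟨e₂, he₂, g, hg, hRg⟩ := h2
  -- THE PRINTED IDENTITY: `X₁|h(1)|² + X₂|g(z₂)|² = 0`
  have hid := boundaryIdentity_of_im_eq_zero hz₂ (L := fun z => z * (z - 1) * (z - z₂))
    (C := fun z => ctdcTildeCoeff (s : ℂ) (etaCauchy M a Λ ωr m) (etaEvent M a Λ ωr m)
      (etaCosmo M a Λ ωr m) (ctdcLT M a Λ ωr m (lambdaBar a Λ s ωr m lam)) (z₂ : ℂ)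
      (rMinus M a Λ) (rPlus M a Λ) (rCosmo M a Λ) z)
    hLne (fun z _ => hC z) hode' hq₁ hq₂ he₁ hh hRh he₂ hg hRg
  -- the signs off the window
  obtain ⟨hprod, hnotboth⟩ := realAxis_exponent_signs hsub ha hωr0 hthird
  set X₁ : ℝ := (1 / 2 + etaCauchy M a Λ (ωr : ℂ) m + etaEvent M a Λ (ωr : ℂ) m).im with hX₁
  set X₂ : ℝ := (1 / 2 - etaCauchy M a Λ (ωr : ℂ) m - etaCosmo M a Λ (ωr : ℂ) m).im with hX₂
  have hN₁ : 0 ≤ normSq (h 1) := normSq_nonneg _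
  have hN₂ : 0 ≤ normSq (g z₂) := normSq_nonneg _
  -- `Re P = 1 > 0` at both horizons
  have hP1 : 0 < (2 * (1 / 2 + etaCauchy M a Λ (ωr : ℂ) m + etaEvent M a Λ (ωr : ℂ) m)).re := by
    norm_num [Complex.mul_re, hq₁]
  have hP2 : 0 < (2 * (1 / 2 - etaCauchy M a Λ (ωr : ℂ) m - etaCosmo M a Λ (ωr : ℂ) m)).re := by
    norm_num [Complex.mul_re, hq₂]
  by_cases hX₁0 : X₁ = 0
  · -- the cosmological amplitude vanishes
    have hX₂0 : X₂ ≠ 0 := fun h0 => hnotboth ⟨hX₁0, h0⟩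
    have hN₂0 : normSq (g z₂) = 0 := by
      rw [hX₁0, zero_mul, zero_add] at hid
      exact (mul_eq_zero.1 hid).resolve_left hX₂0
    have hg0 : g z₂ = 0 := Complex.normSq_eq_zero.1 hN₂0
    exact ctdcTilde_eq_zero_of_cosmoAmplitude_eq_zero hz₂ h10 h23 h12' hP2 hode' he₂ hg hRg hg0
  · -- the event-horizon amplitude vanishes
    have hN₁0 : normSq (h 1) = 0 := by
      have e1 : X₁ ^ 2 * normSq (h 1) = -(X₁ * X₂) * normSq (g z₂) := by
        linear_combination X₁ * hid
      have e2 : X₁ ^ 2 * normSq (h 1) ≤ 0 := by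
        rw [e1]
        have h4 := mul_nonneg hprod hN₂
        linarith
      have e3 : 0 < X₁ ^ 2 := by positivity
      by_contra hne
      have h5 : 0 < normSq (h 1) := lt_of_le_of_ne hN₁ (Ne.symm hne)
      have h6 := mul_pos e3 h5
      linarith
    have hh0 : h 1 = 0 := Complex.normSq_eq_zero.1 hN₁0
    exact ctdcTilde_eq_zero_of_eventAmplitude_eq_zero hz₂ h10 h23 h12' hP1 hode' he₁ hh hRh hh0

end Assembly

end Literature.Geometry.Lorentzian.KerrDeSitter
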